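import Literature.Probability.RandomPlanarGeometry.SLEKappaRhoMartingaleReduction
import HarnessLib

/-!
# [LSW] §8.4: Lemma 8.10 for the slid hulls along any driving function, and the reduction of `exists_isOneSidedMartingale` to Lemma 8.9 GIVEN boundedness

Complement to `SLEKappaRhoMartingaleReduction` (which proves
`SLEKappaRho.exists_isOneSidedMartingale` from the existence of a martingale extension
`SLEKappaRho.IsMartingaleExtension` for every SLE(8/3, ρ) pair and smooth `A ∈ 𝒬₊`), after

* G. F. Lawler, O. Schramm, W. Werner, *Conformal restriction: the chordal case*, J. Amer. Math.
  Soc. **16** (2003) 917–955, arXiv:math/0209343 (**[LSW]**), §8.4: Lemma 8.9 ("`(M_t, t < T)`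
  is a local martingale"), Lemma 8.10 ("There exists `ε > 0` such that `M_t ≤ h_t'(W_t)^ε` for all
  `t < T`. In particular, `M_t ≤ 1`") with (8.2), and the end of the proof of Thm. 8.4 ("since
  `M_t` converges a.s. and in `L¹` when `t → T`").

In print the boundedness `0 ≤ M_t ≤ 1` that turns the local martingale of Lemma 8.9 into a
convergent bounded martingale is Lemma 8.10, which is PROVED in the tree
(`SLEKappaRho.oneSidedM_bounds_of_isArcHull`, `SLEKappaRhoLemma810`). This file records that
consequence in the two forms the stochastic-calculus leaf may want to consume, and the
corresponding sharper reduction (theorems only):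

* `SLEKappaRho.oneSidedM_bounds_slidHull` — **Lemma 8.10 with (8.2) for the slid hulls
  `A_t − U_t` of an arc (e.g. smooth) hull `A ∈ 𝒬₊` along ANY continuous driving function with
  `U_0 = 0`**, at every time with `K̂_t ∩ A = ∅` and every `o ≤ 0`:
  `e^{max(5/8, α)} ≤ oneSidedM ρ (A_t − U_t) o ≤ e^{min(5/8, α)}`, `e = hullDeriv (A_t − U_t)` (the
  slid hull is an arc `+`-hull, `SLEKappaRhoSlidArc`);
* `SLEKappaRho.ae_oneSidedM_bounds` — along an SLE(8/3, ρ) pair: a.s., for all `t < T_A`, these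
  bounds hold and in particular `M_t = oneSidedM ρ (A_t − W_t) (O_t − W_t) ∈ [0, 1]` (a.s.
  continuity of the paths by the proved integrated Bessel equation `integral_inv_eq_holds`);
* `SLEKappaRho.exists_isOneSidedMartingale_of_exists_isMartingaleExtension` — **the named fact
  from Lemma 8.9's content alone, with Lemma 8.10 supplied**: it suffices that a martingale
  extension exists for every SLE(8/3, ρ) pair and smooth `A ∈ 𝒬₊` GIVEN that the formula process
  is a.s. `[0, 1]`-valued before `T_A` (the premise is discharged by `ae_oneSidedM_bounds`, the
  conclusion fed to `exists_isOneSidedMartingale_of_extension`).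
-/

noncomputable section

open Set Filter MeasureTheory
open scoped NNReal ENNReal Topology
open UpperHalfPlane (upperHalfPlaneSet)
open Literature.Probability.Process (preWienerMeasure)

namespace Literature.Probability.RandomPlanarGeometry

namespace SLEKappaRho

variable {ρ : ℝ} {O W : ℝ≥0 → (ℝ≥0 → ℝ) → ℝ} {A : Set ℂ}

/-- **[LSW] Lemma 8.10 with (8.2), for the slid hulls of an arc hull `A ∈ 𝒬₊`** along any
continuous driving function with `U_0 = 0`, at a time at which the closed hull misses `A`: with
`B = A_t − U_t` and `e = Φ'_B(0) = h_t'(U_t) = hullDeriv B`,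
`e^{max(5/8, α)} ≤ oneSidedM ρ B o ≤ e^{min(5/8, α)}` for every `o ≤ 0`.
[cite: LawlerSchrammWerner2003Restriction, Lemma 8.10 with (8.2)] -/
theorem oneSidedM_bounds_slidHull (hρ : -2 < ρ) {U : ℝ≥0 → ℝ} (hU : Continuous U) (hU0 : U 0 = 0)
    (hA : IsArcHull A) (hA' : IsPlusHull A) {t : ℝ≥0} (hdisj : Disjoint (Loewner.closedHull U t) A)
    {o : ℝ} (ho : o ≤ 0) :
    hullDeriv (Loewner.slidHull U A t) ^ max (5 / 8 : ℝ) (sleKappaRhoExponent ρ) ≤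
        oneSidedM ρ (Loewner.slidHull U A t) o ∧
      oneSidedM ρ (Loewner.slidHull U A t) o ≤
        hullDeriv (Loewner.slidHull U A t) ^ min (5 / 8 : ℝ) (sleKappaRhoExponent ρ) :=
  oneSidedM_bounds_of_isArcHull hρ
    (Loewner.isArcHull_slidHull_of_disjoint hU hA hA'.1.zero_notMem hdisj)
    (Loewner.isPlusHull_slidHull_of_disjoint hU hU0 hA' hdisj) ho

/-- **Lemma 8.10 along the SLE(8/3, ρ) paths**: a.s., for all `t < T_A`, with `B = A_t − W_t`,
`(hullDeriv B)^{max(5/8, α)} ≤ M_t ≤ (hullDeriv B)^{min(5/8, α)}`, in particular `M_t ∈ [0, 1]` —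
the deterministic bounds on the a.s. event where the driving function is continuous
(`ae_continuous_snd`, from the proved integrated Bessel equation).
[cite: LawlerSchrammWerner2003Restriction, Lemma 8.10 and (8.2)] -/
theorem ae_oneSidedM_bounds (hρ : -2 < ρ)
    (hOW : IsSLEKappaRhoPair (8 / 3) ρ O W) (hAs : IsSmoothHull A) (hA : IsPlusHull A) :
    ∀ᵐ ω ∂preWienerMeasure, ∀ t : ℝ≥0,
      (t : WithTop ℝ≥0) < Loewner.hullHitTime (fun s ↦ W s ω) A →
        hullDeriv (Loewner.slidHull (fun s ↦ W s ω) A t) ^ max (5 / 8 : ℝ) (sleKappaRhoExponent ρ) ≤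
            oneSidedM ρ (Loewner.slidHull (fun s ↦ W s ω) A t) (O t ω - W t ω) ∧
          oneSidedM ρ (Loewner.slidHull (fun s ↦ W s ω) A t) (O t ω - W t ω) ≤
            hullDeriv (Loewner.slidHull (fun s ↦ W s ω) A t) ^ min (5 / 8 : ℝ) (sleKappaRhoExponent ρ) ∧
          oneSidedM ρ (Loewner.slidHull (fun s ↦ W s ω) A t) (O t ω - W t ω) ∈ Icc (0 : ℝ) 1 := by
  filter_upwards [ae_continuous_snd hρ hOW] with ω hω t ht
  obtain ⟨h1, h2⟩ := oneSidedM_bounds_slidHull hρ hω (hOW.snd_zero ω) hAs.isArcHull hA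
    (Loewner.disjoint_closedHull_of_lt_hullHitTime ht) (sub_nonpos.2 (hOW.le t ω))
  exact ⟨h1, h2, (hullDeriv_rpow_mem_Ioc _ (exponent_max_pos ρ).le).1.le.trans h1,
    h2.trans (hullDeriv_rpow_mem_Ioc _ (exponent_min_pos hρ).le).2⟩

/-- **`SLEKappaRho.exists_isOneSidedMartingale` from Lemma 8.9's content with Lemma 8.10
supplied**: it suffices that, for every SLE(8/3, ρ) pair and smooth `A ∈ 𝒬₊`, a martingale
extension of the formula process (`IsMartingaleExtension`: the conclusion of [LSW] Lemma 8.9 with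
the convergence clause) exists GIVEN that the formula process is a.s. `[0, 1]`-valued before `T_A`
— which it is, by Lemma 8.10 (`ae_oneSidedM_bounds`); then
`exists_isOneSidedMartingale_of_extension` (`SLEKappaRhoMartingaleReduction`) concludes.
[cite: LawlerSchrammWerner2003Restriction, §8.4: Lemma 8.9, Lemma 8.10 with (8.2), and the end of the proof of Thm. 8.4] -/
theorem exists_isOneSidedMartingale_of_exists_isMartingaleExtension
    (h89 : ∀ {ρ : ℝ} {O W : ℝ≥0 → (ℝ≥0 → ℝ) → ℝ}, -2 < ρ → IsSLEKappaRhoPair (8 / 3) ρ O W →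
      ∀ {A : Set ℂ}, IsSmoothHull A → IsPlusHull A →
        (∀ᵐ ω ∂preWienerMeasure, ∀ t : ℝ≥0,
            (t : WithTop ℝ≥0) < Loewner.hullHitTime (fun s ↦ W s ω) A →
              oneSidedM ρ (Loewner.slidHull (fun s ↦ W s ω) A t) (O t ω - W t ω) ∈ Icc (0 : ℝ) 1) →
        ∃ M, IsMartingaleExtension ρ A O W M) :
    exists_isOneSidedMartingale :=
  exists_isOneSidedMartingale_of_extension fun hρ hOW _ hAs hA ↦
    h89 hρ hOW hAs hA ((ae_oneSidedM_bounds hρ hOW hAs hA).mono fun _ hω t ht ↦ (hω t ht).2.2)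

end SLEKappaRho

end Literature.Probability.RandomPlanarGeometry

end
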